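import Summits.BirchSwinnertonDyer.BirchSwinnertonDyer.Theorems.EisensteinPrimesBSDpOnCellCStubC3MuLambdaInvariants
import HarnessLib

/-!
# Crux 4 `BSDpOnCellC` (stmt-BirchSwinnertonDyer-19034), line b1 v10, stub `stub_c3`: EACH DIVISIBILITY
# ROAD NEEDS ONLY ONE `λ`-INEQUALITY — c3♭′ / c3s♭′ at `𝔭̄` from [road R-β (Kolyvagin) + `μ = 0` both
# sides + `λ(𝓛) ≤ λ(X_ac^∅)`] or from [road H (Hida limit) + `μ = 0` both sides + `λ(X_ac^∅) ≤ λ(𝓛)`],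
# in the module-invariant currency of p609918 (cell `bsd-eis`, seat `bsd-line-x2-p2` gen 2, D-0154 KEY
# row 5; route `EisensteinPrimes`)

HONEST FRAMING (cell `bsd-eis`, run/shared/lean/pub/bsd-eis/): pure commutative algebra of the wide
receptacle `𝓞_{ℂ_p}⟦T⟧` plus conditional re-statements of the typed halves of the IMC atom of line b1;
everything is PROVED from tree theorems; nothing about any curve is asserted; nothing booked; X2 stays
CONSTRUCTION-SHAPED; no label or count moves; BSD and the anticyclotomic main conjecture are proved for
no curve. Helper attached to stmt-BirchSwinnertonDyer-19034 (`--supports`), closes no stub.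

## Why

The PUB-tier residual of `stub_c3` is [one divisibility half at `𝔭̄`] + [D′ at `𝔭̄`], glued by
`X2.…IMCEqOnTreeIntOther_of_divIntOther_of_muLambdaIntOther` /
`…_of_hidaLimitRevDivIntOther_of_muLambdaIntOther` (p489067): D′ asks `μ = 0` on BOTH sides AND the
EQUALITY `λ(X_ac^∅) = λ(𝓛)` (Keller–Yin `algmain`; Castella–Grossi–Skinner obtain it as two
inequalities from two different sources). But a divisibility between two `μ = 0` series already
carries one inequality of Weierstrass degrees for free (degrees add, Washington §7.1): with road R-β
(`𝓕♭ ∣ p^k 𝓛`, the Euler-system upper bound on Selmer) `λ(X_ac^∅) ≤ λ(𝓛)` is automatic, with road H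
(`𝓛 ∣ p^a 𝓕♭`) `λ(𝓛) ≤ λ(X_ac^∅)` is. So EACH road needs only the OPPOSITE inequality:

* §1 algebra in `𝓞_{ℂ_p}⟦T⟧`: `le_of_C_pow_mul_mem` (the free inequality) and
  `span_singleton_eq_of_C_pow_mul_mem_of_le` (equality of ideals from `p^k L ∈ (F)`, shapes of `F` at
  `n` and of `L` at `m`, and the ONE inequality `m ≤ n`) — a one-line sharpening of
  `CpIntSeries.span_singleton_eq_of_C_pow_mul_mem` (which asks `m = n`).
* §2 c3♭′ / c3s♭′ from ROAD R-β + [at every datum: `X_ac^∅` strict at `𝔭̄` is `Λ`-torsion, `μ(X_ac^∅) = 0`,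
  and the frame `Q` has its first unit coefficient at some `m ≤ λ(X_ac^∅)`] —
  `nonsplit/splitIMCEqOnTreeIntOther_of_divIntOther_of_lambda_le`.
* §3 c3♭′ / c3s♭′ from ROAD H + [torsion, `μ(X_ac^∅) = 0`, `Q` has its first unit coefficient at some
  `m ≥ λ(X_ac^∅)`] — `nonsplit/splitIMCEqOnTreeIntOther_of_hidaLimitRevDivIntOther_of_le_lambda`.

In stub currency for the OWNER and the planner: on road R-β the `λ`-half of D′ that remains is the LOWER
BOUND `λ(X_ac^∅) ≥ λ(𝓛^BDP)` (the «Eisenstein-congruence» direction); on road H it is the UPPER BOUND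
`λ(X_ac^∅) ≤ λ(𝓛^BDP)` (the Euler-system direction) — never both. What this is NOT: not a proof of either
divisibility, of torsion, of `μ = 0`, or of either inequality; `stub_c3` is untouched.

References: [Washington1997] §7.1 Prop. 7.2 / Thm. 7.3, §13.2; [KellerYin2024] §5.1 (`algmain`), Thm. 5.1.3
(arXiv:2402.12781v2, PRE — locator only, nothing taken); [CastellaGrossiSkinner2025] (the two-inequality
structure of the Eisenstein-prime argument; context only); cell: RULING L31, p489067, p609918.
-/

set_option autoImplicit false
set_option linter.dupNamespace false -- the summit namespace `…BirchSwinnertonDyer.BirchSwinnertonDyer.Theorems` (Sub = Summit, D-0017) trips it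

noncomputable section

open scoped Classical MatrixGroups ModularForm

open CongruenceSubgroup WeierstrassCurve NumberField IsDedekindDomain Field PowerSeries
  Literature.NumberTheory.EllipticCurves Literature.NumberTheory.EllipticCurves.GreenbergSelmer
  Literature.NumberTheory.EllipticCurves.GreenbergVatsal2000
  Literature.NumberTheory.EllipticCurves.ModularForms
  Literature.NumberTheory.EllipticCurves.Rank1Residual
  Literature.NumberTheory.EllipticCurves.Rank1Residual.Typed
  Literature.NumberTheory.GaloisRepresentations Literature.NumberTheory.GaloisCohomology
  Literature.NumberTheory.Automorphic
  Summit.BirchSwinnertonDyer.Rank1Residual.X11b.AcSelmer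
  Summit.BirchSwinnertonDyer.Rank1Residual.X11b.Halves
  Summit.BirchSwinnertonDyer.Rank1Residual.X11b
  Summit.BirchSwinnertonDyer.Rank1Residual Summit.BirchSwinnertonDyer.Rank1Residual.X1
  Summit.BirchSwinnertonDyer.Rank1Residual.X2
  Summit.BirchSwinnertonDyer.BirchSwinnertonDyer.Theorems.StubC3MuLambdaInvariants

namespace Summit.BirchSwinnertonDyer.BirchSwinnertonDyer.Theorems.StubC3OneInequality

variable {p : ℕ} [Fact p.Prime]

/-! ### §1 One divisibility + shapes ⇒ one inequality is free; equality from the other one -/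

/-- **The free inequality.** In `𝓞_{ℂ_p}⟦T⟧`: if `p^k · L ∈ (F)`, `F` has its first unit coefficient at
`n` and `L` at `m`, then `n ≤ m` (cancel `p^k` by the Gauss-norm lemma, then Weierstrass degrees add).
[cite: Washington1997, §7.1 (Prop. 7.2, Thm. 7.3)] -/
theorem le_of_C_pow_mul_mem {F L : PowerSeries 𝓞_ℂ_[p]} {k n m : ℕ}
    (hdiv : C ((p : 𝓞_ℂ_[p]) ^ k) * L ∈ Ideal.span ({F} : Set (PowerSeries 𝓞_ℂ_[p])))
    (hF : ‖((coeff n F : 𝓞_ℂ_[p]) : ℂ_[p])‖ = 1 ∧ ∀ i < n, ‖((coeff i F : 𝓞_ℂ_[p]) : ℂ_[p])‖ < 1)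
    (hL : ‖((coeff m L : 𝓞_ℂ_[p]) : ℂ_[p])‖ = 1 ∧ ∀ i < m, ‖((coeff i L : 𝓞_ℂ_[p]) : ℂ_[p])‖ < 1) :
    n ≤ m := by
  obtain ⟨G, hG⟩ := Ideal.mem_span_singleton'.mp hdiv
  obtain ⟨G', hG'⟩ := CpIntSeries.exists_mul_eq_of_mul_eq_C_pow_mul hF (by rw [← hG, mul_comm])
  obtain ⟨b, -, hab⟩ := CpIntSeries.exists_firstUnitCoeffAt_right hF
    (hG'.symm ▸ hL : ‖((coeff m (F * G') : 𝓞_ℂ_[p]) : ℂ_[p])‖ = 1 ∧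
      ∀ i < m, ‖((coeff i (F * G') : 𝓞_ℂ_[p]) : ℂ_[p])‖ < 1)
  omega

/-- **Equality of ideals from ONE inequality.** In `𝓞_{ℂ_p}⟦T⟧`: `p^k · L ∈ (F)`, `F` with first unit
coefficient at `n`, `L` at `m`, and `m ≤ n` ⟹ `(F) = (L)` (the other inequality is free, so `m = n`
and `CpIntSeries.span_singleton_eq_of_C_pow_mul_mem` applies). [cite: Washington1997, §7.1 (Prop. 7.2, Thm. 7.3)] -/
theorem span_singleton_eq_of_C_pow_mul_mem_of_le {F L : PowerSeries 𝓞_ℂ_[p]} {k n m : ℕ}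
    (hdiv : C ((p : 𝓞_ℂ_[p]) ^ k) * L ∈ Ideal.span ({F} : Set (PowerSeries 𝓞_ℂ_[p])))
    (hF : ‖((coeff n F : 𝓞_ℂ_[p]) : ℂ_[p])‖ = 1 ∧ ∀ i < n, ‖((coeff i F : 𝓞_ℂ_[p]) : ℂ_[p])‖ < 1)
    (hL : ‖((coeff m L : 𝓞_ℂ_[p]) : ℂ_[p])‖ = 1 ∧ ∀ i < m, ‖((coeff i L : 𝓞_ℂ_[p]) : ℂ_[p])‖ < 1)
    (hmn : m ≤ n) :
    Ideal.span ({F} : Set (PowerSeries 𝓞_ℂ_[p])) = Ideal.span {L} := by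
  obtain rfl : m = n := le_antisymm hmn (le_of_C_pow_mul_mem hdiv hF hL)
  exact CpIntSeries.span_singleton_eq_of_C_pow_mul_mem hdiv hF hL

/-! ### §2 Road R-β: c3♭′ / c3s♭′ from the Kolyvagin half + `μ = 0` + `λ(𝓛) ≤ λ(X_ac^∅)` -/

section Roads

variable {W : WeierstrassCurve ℚ} [W.IsElliptic] [W.IsGloballyMinimal]

omit [W.IsGloballyMinimal] in
/-- **c3♭′ from ROAD R-β and ONE inequality.** `X2.NonsplitKolyvaginDivOnTreeIntOther W p` (`𝓕♭ ∣ p^k Q` at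
every datum) together with, at every datum: `X := X_ac^∅(E_K[p^∞])` strict at `𝔭̄` is `Λ`-torsion,
`μ(X) = 0`, and the frame `Q` has its first unit coefficient at some `m ≤ λ(X)` (i.e. `μ(𝓛) = 0` and
`λ(𝓛) ≤ λ(X)`), gives `X2.NonsplitIMCEqOnTreeIntOther W p`; the inequality `λ(X) ≤ λ(𝓛)` is free (§1).
Hypothesis stated INLINE (no new `Prop`); CONDITIONAL; nothing booked.
[cite: KellerYin2024, §5.1 (`algmain`) and Thm. 5.1.3 = Thm. D (arXiv:2402.12781v2) (shape only; nothing asserted)]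
[cite: Washington1997, §13.2 and §7.1 Prop. 7.2] -/
theorem nonsplitIMCEqOnTreeIntOther_of_divIntOther_of_lambda_le
    (hdiv : NonsplitKolyvaginDivOnTreeIntOther W p)
    (h :
    ∀ (N : ℕ) [NeZero N] (K : Type) [Field K] [NumberField K] (Dt : ModularParametrizationData W N)
      (H : HeegnerDatum N (NumberField.discr K)) (ιK : K →+* ℂ) (P : (W.baseChange K).toAffine.Point),
      CellC W p → ¬ W.HasSplitMultiplicativeReductionAtPrime p → W.conductorNorm ℤ = N →
      IsImaginaryQuadratic K → NumberField.discr K < -4 → SatisfiesHeegnerHypothesis N K →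
      (W.quadraticTwist (NumberField.discr K : ℚ)).entireLFunction 1 ≠ 0 →
      WeierstrassCurve.Affine.Point.map ιK.toRatAlgHom P = heegnerPointComplex Dt H →
      ¬ (p : ℤ) ∣ Dt.c → ¬ IsOfFinAddOrder P →
      Odd (NumberField.discr K) →
      ∀ (κ : ZpExtension K p), κ.IsAnticyclotomic →
        ∀ (γ : Field.absoluteGaloisGroup K) [Fact (κ.IsTopGenerator γ)]
          (𝔭 : HeightOneSpectrum (𝓞 K)), ((p : ℕ) : 𝓞 K) ∈ 𝔭.asIdeal →
          𝔭.asIdeal.ramificationIdx (𝓞 ℚ) = 1 → 𝔭.asIdeal.inertiaDeg (𝓞 ℚ) = 1 →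
          ∀ (𝔭bar : HeightOneSpectrum (𝓞 K)), ((p : ℕ) : 𝓞 K) ∈ 𝔭bar.asIdeal → 𝔭bar ≠ 𝔭 →
            ((Ideal.span {(p : ℤ)}).primesOver (𝓞 K)).ncard = 2 →
          ∀ (f : CuspForm (CongruenceSubgroup.Gamma0 N) 2), IsNewformOf W f →
            ∀ (ι' : PadicAlgCl p ≃+* ℂ),
              (∀ (w : InfinitePlace K) (k : 𝓞 K),
                k ∈ 𝔭.asIdeal ↔ ‖ι'.symm (w.embedding (k : K))‖ < 1) →
              ∀ (ΩK : ℂ) (Ωp : ℂ_[p]) (Q : PowerSeries 𝓞_ℂ_[p]), ΩK ≠ 0 → ‖Ωp‖ = 1 →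
                R1.IsBDPLFunctionInt p ι' 𝔭 κ γ f ΩK Ωp Q →
                  Module.IsTorsion (IwasawaAlgebra p) (XAc (W.baseChange K) p κ 𝔭bar ∅ γ) ∧
                  muInvariant p (XAc (W.baseChange K) p κ 𝔭bar ∅ γ) = 0 ∧
                  ∃ m ≤ lambdaInvariant p (XAc (W.baseChange K) p κ 𝔭bar ∅ γ),
                    ‖((PowerSeries.coeff m Q : 𝓞_ℂ_[p]) : ℂ_[p])‖ = 1 ∧
                      ∀ i < m, ‖((PowerSeries.coeff i Q : 𝓞_ℂ_[p]) : ℂ_[p])‖ < 1) :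
    NonsplitIMCEqOnTreeIntOther W p := by
  intro N _ K _ _ Dt H ιK P hc hns hN hK hd4 hHN hLt hP hcM hPinf hodd κ hκ γ _ 𝔭 h𝔭 he hf 𝔭bar h𝔭bar
    hne hsplit f hfW ι' hι' ΩK Ωp Q hΩK hΩp hQ
  obtain ⟨F, hF⟩ :=
    (charIdeal_isPrincipal_holds p (XAc (W.baseChange K) p κ 𝔭bar ∅ γ)).principal
  have hchar : XAc.charIdeal (W.baseChange K) p κ 𝔭bar ∅ γ = Ideal.span {F} := hF
  obtain ⟨k, hk⟩ := hdiv N K Dt H ιK P hc hns hN hK hd4 hHN hLt hP hcM hPinf hodd κ hκ γ 𝔭 h𝔭 he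
    hf 𝔭bar h𝔭bar hne hsplit f hfW ι' hι' ΩK Ωp Q hΩK hΩp hQ
  obtain ⟨htor, hμ, m, hm, hQm⟩ := h N K Dt H ιK P hc hns hN hK hd4 hHN hLt hP hcM hPinf hodd κ hκ γ 𝔭 h𝔭 he
    hf 𝔭bar h𝔭bar hne hsplit f hfW ι' hι' ΩK Ωp Q hΩK hΩp hQ
  haveI := module_finite_XAc_baseChange (W := W) p κ 𝔭bar γ
  have hFn := firstUnitCoeff_map_toCpInt_of_charIdeal_eq_span _ htor hμ hchar
  unfold R1.IMCEqIntAt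
  rw [hchar, Ideal.map_span, Set.image_singleton] at hk ⊢
  exact span_singleton_eq_of_C_pow_mul_mem_of_le hk hFn hQm hm

omit [W.IsGloballyMinimal] in
/-- **c3s♭′ from ROAD R-β and ONE inequality.** `X2.SplitKolyvaginDivOnTreeIntOther W p` (`𝓕♭ ∣ p^k Q` at
every datum) together with, at every datum: `X := X_ac^∅(E_K[p^∞])` strict at `𝔭̄` is `Λ`-torsion,
`μ(X) = 0`, and the frame `Q` has its first unit coefficient at some `m ≤ λ(X)` (i.e. `μ(𝓛) = 0` and
`λ(𝓛) ≤ λ(X)`), gives `X2.SplitIMCEqOnTreeIntOther W p`; the inequality `λ(X) ≤ λ(𝓛)` is free (§1).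
Hypothesis stated INLINE (no new `Prop`); CONDITIONAL; nothing booked.
[cite: KellerYin2024, §5.1 (`algmain`) and Thm. 5.1.3 = Thm. D (arXiv:2402.12781v2) (shape only; nothing asserted)]
[cite: Washington1997, §13.2 and §7.1 Prop. 7.2] -/
theorem splitIMCEqOnTreeIntOther_of_divIntOther_of_lambda_le
    (hdiv : SplitKolyvaginDivOnTreeIntOther W p)
    (h :
    ∀ (N : ℕ) [NeZero N] (K : Type) [Field K] [NumberField K] (Dt : ModularParametrizationData W N)
      (H : HeegnerDatum N (NumberField.discr K)) (ιK : K →+* ℂ) (P : (W.baseChange K).toAffine.Point),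
      CellC W p → W.HasSplitMultiplicativeReductionAtPrime p → W.conductorNorm ℤ = N →
      IsImaginaryQuadratic K → NumberField.discr K < -4 → SatisfiesHeegnerHypothesis N K →
      (W.quadraticTwist (NumberField.discr K : ℚ)).entireLFunction 1 ≠ 0 →
      WeierstrassCurve.Affine.Point.map ιK.toRatAlgHom P = heegnerPointComplex Dt H →
      ¬ (p : ℤ) ∣ Dt.c → ¬ IsOfFinAddOrder P →
      Odd (NumberField.discr K) →
      ∀ (κ : ZpExtension K p), κ.IsAnticyclotomic →
        ∀ (γ : Field.absoluteGaloisGroup K) [Fact (κ.IsTopGenerator γ)]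
          (𝔭 : HeightOneSpectrum (𝓞 K)), ((p : ℕ) : 𝓞 K) ∈ 𝔭.asIdeal →
          𝔭.asIdeal.ramificationIdx (𝓞 ℚ) = 1 → 𝔭.asIdeal.inertiaDeg (𝓞 ℚ) = 1 →
          ∀ (𝔭bar : HeightOneSpectrum (𝓞 K)), ((p : ℕ) : 𝓞 K) ∈ 𝔭bar.asIdeal → 𝔭bar ≠ 𝔭 →
            ((Ideal.span {(p : ℤ)}).primesOver (𝓞 K)).ncard = 2 →
          ∀ (f : CuspForm (CongruenceSubgroup.Gamma0 N) 2), IsNewformOf W f →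
            ∀ (ι' : PadicAlgCl p ≃+* ℂ),
              (∀ (w : InfinitePlace K) (k : 𝓞 K),
                k ∈ 𝔭.asIdeal ↔ ‖ι'.symm (w.embedding (k : K))‖ < 1) →
              ∀ (ΩK : ℂ) (Ωp : ℂ_[p]) (Q : PowerSeries 𝓞_ℂ_[p]), ΩK ≠ 0 → ‖Ωp‖ = 1 →
                R1.IsBDPLFunctionInt p ι' 𝔭 κ γ f ΩK Ωp Q →
                  Module.IsTorsion (IwasawaAlgebra p) (XAc (W.baseChange K) p κ 𝔭bar ∅ γ) ∧
                  muInvariant p (XAc (W.baseChange K) p κ 𝔭bar ∅ γ) = 0 ∧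
                  ∃ m ≤ lambdaInvariant p (XAc (W.baseChange K) p κ 𝔭bar ∅ γ),
                    ‖((PowerSeries.coeff m Q : 𝓞_ℂ_[p]) : ℂ_[p])‖ = 1 ∧
                      ∀ i < m, ‖((PowerSeries.coeff i Q : 𝓞_ℂ_[p]) : ℂ_[p])‖ < 1) :
    SplitIMCEqOnTreeIntOther W p := by
  intro N _ K _ _ Dt H ιK P hc hs hN hK hd4 hHN hLt hP hcM hPinf hodd κ hκ γ _ 𝔭 h𝔭 he hf 𝔭bar h𝔭bar
    hne hsplit f hfW ι' hι' ΩK Ωp Q hΩK hΩp hQ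
  obtain ⟨F, hF⟩ :=
    (charIdeal_isPrincipal_holds p (XAc (W.baseChange K) p κ 𝔭bar ∅ γ)).principal
  have hchar : XAc.charIdeal (W.baseChange K) p κ 𝔭bar ∅ γ = Ideal.span {F} := hF
  obtain ⟨k, hk⟩ := hdiv N K Dt H ιK P hc hs hN hK hd4 hHN hLt hP hcM hPinf hodd κ hκ γ 𝔭 h𝔭 he
    hf 𝔭bar h𝔭bar hne hsplit f hfW ι' hι' ΩK Ωp Q hΩK hΩp hQ
  obtain ⟨htor, hμ, m, hm, hQm⟩ := h N K Dt H ιK P hc hs hN hK hd4 hHN hLt hP hcM hPinf hodd κ hκ γ 𝔭 h𝔭 he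
    hf 𝔭bar h𝔭bar hne hsplit f hfW ι' hι' ΩK Ωp Q hΩK hΩp hQ
  haveI := module_finite_XAc_baseChange (W := W) p κ 𝔭bar γ
  have hFn := firstUnitCoeff_map_toCpInt_of_charIdeal_eq_span _ htor hμ hchar
  unfold R1.IMCEqIntAt
  rw [hchar, Ideal.map_span, Set.image_singleton] at hk ⊢
  exact span_singleton_eq_of_C_pow_mul_mem_of_le hk hFn hQm hm

/-! ### §3 Road H: c3♭′ / c3s♭′ from the Hida-limit half + `μ = 0` + `λ(X_ac^∅) ≤ λ(𝓛)` -/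

omit [W.IsGloballyMinimal] in
/-- **c3♭′ from ROAD H and ONE inequality.** `X2.HidaLimitRevDivOnTreeIntOther W p`
(`Q ∣ p^a 𝓕♭` at every datum, sign-free) together with, at every datum of this sign: `X := X_ac^∅`
strict at `𝔭̄` `Λ`-torsion, `μ(X) = 0`, and `Q` with first unit coefficient at some `m ≥ λ(X)` (i.e.
`μ(𝓛) = 0` and `λ(X) ≤ λ(𝓛)`), gives `X2.NonsplitIMCEqOnTreeIntOther W p`; here `λ(𝓛) ≤ λ(X)` is free (§1).
Hypothesis stated INLINE; CONDITIONAL; nothing booked.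
[cite: KellerYin2024, §5.1 (a)–(e), Lemma 5.1.2 and Thm. 5.1.3 (arXiv:2402.12781v2) (shape only; nothing asserted)]
[cite: Washington1997, §13.2 and §7.1 Prop. 7.2] -/
theorem nonsplitIMCEqOnTreeIntOther_of_hidaLimitRevDivIntOther_of_le_lambda
    (hrev : HidaLimitRevDivOnTreeIntOther W p)
    (h :
    ∀ (N : ℕ) [NeZero N] (K : Type) [Field K] [NumberField K] (Dt : ModularParametrizationData W N)
      (H : HeegnerDatum N (NumberField.discr K)) (ιK : K →+* ℂ) (P : (W.baseChange K).toAffine.Point),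
      CellC W p → ¬ W.HasSplitMultiplicativeReductionAtPrime p → W.conductorNorm ℤ = N →
      IsImaginaryQuadratic K → NumberField.discr K < -4 → SatisfiesHeegnerHypothesis N K →
      (W.quadraticTwist (NumberField.discr K : ℚ)).entireLFunction 1 ≠ 0 →
      WeierstrassCurve.Affine.Point.map ιK.toRatAlgHom P = heegnerPointComplex Dt H →
      ¬ (p : ℤ) ∣ Dt.c → ¬ IsOfFinAddOrder P →
      Odd (NumberField.discr K) →
      ∀ (κ : ZpExtension K p), κ.IsAnticyclotomic →
        ∀ (γ : Field.absoluteGaloisGroup K) [Fact (κ.IsTopGenerator γ)]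
          (𝔭 : HeightOneSpectrum (𝓞 K)), ((p : ℕ) : 𝓞 K) ∈ 𝔭.asIdeal →
          𝔭.asIdeal.ramificationIdx (𝓞 ℚ) = 1 → 𝔭.asIdeal.inertiaDeg (𝓞 ℚ) = 1 →
          ∀ (𝔭bar : HeightOneSpectrum (𝓞 K)), ((p : ℕ) : 𝓞 K) ∈ 𝔭bar.asIdeal → 𝔭bar ≠ 𝔭 →
            ((Ideal.span {(p : ℤ)}).primesOver (𝓞 K)).ncard = 2 →
          ∀ (f : CuspForm (CongruenceSubgroup.Gamma0 N) 2), IsNewformOf W f →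
            ∀ (ι' : PadicAlgCl p ≃+* ℂ),
              (∀ (w : InfinitePlace K) (k : 𝓞 K),
                k ∈ 𝔭.asIdeal ↔ ‖ι'.symm (w.embedding (k : K))‖ < 1) →
              ∀ (ΩK : ℂ) (Ωp : ℂ_[p]) (Q : PowerSeries 𝓞_ℂ_[p]), ΩK ≠ 0 → ‖Ωp‖ = 1 →
                R1.IsBDPLFunctionInt p ι' 𝔭 κ γ f ΩK Ωp Q →
                  Module.IsTorsion (IwasawaAlgebra p) (XAc (W.baseChange K) p κ 𝔭bar ∅ γ) ∧
                  muInvariant p (XAc (W.baseChange K) p κ 𝔭bar ∅ γ) = 0 ∧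
                  ∃ m, lambdaInvariant p (XAc (W.baseChange K) p κ 𝔭bar ∅ γ) ≤ m ∧
                    ‖((PowerSeries.coeff m Q : 𝓞_ℂ_[p]) : ℂ_[p])‖ = 1 ∧
                      ∀ i < m, ‖((PowerSeries.coeff i Q : 𝓞_ℂ_[p]) : ℂ_[p])‖ < 1) :
    NonsplitIMCEqOnTreeIntOther W p := by
  intro N _ K _ _ Dt H ιK P hc hns hN hK hd4 hHN hLt hP hcM hPinf hodd κ hκ γ _ 𝔭 h𝔭 he hf 𝔭bar h𝔭bar
    hne hsplit f hfW ι' hι' ΩK Ωp Q hΩK hΩp hQ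
  obtain ⟨F, hF⟩ :=
    (charIdeal_isPrincipal_holds p (XAc (W.baseChange K) p κ 𝔭bar ∅ γ)).principal
  have hchar : XAc.charIdeal (W.baseChange K) p κ 𝔭bar ∅ γ = Ideal.span {F} := hF
  obtain ⟨a, ha⟩ := hrev N K Dt H ιK P hc hN hK hd4 hHN hLt hP hcM hPinf hodd κ hκ γ 𝔭 h𝔭 he hf 𝔭bar
    h𝔭bar hne hsplit f hfW ι' hι' ΩK Ωp Q hΩK hΩp hQ
    F hchar
  obtain ⟨htor, hμ, m, hm, hQm⟩ := h N K Dt H ιK P hc hns hN hK hd4 hHN hLt hP hcM hPinf hodd κ hκ γ 𝔭 h𝔭 he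
    hf 𝔭bar h𝔭bar hne hsplit f hfW ι' hι' ΩK Ωp Q hΩK hΩp hQ
  haveI := module_finite_XAc_baseChange (W := W) p κ 𝔭bar γ
  have hFn := firstUnitCoeff_map_toCpInt_of_charIdeal_eq_span _ htor hμ hchar
  unfold R1.IMCEqIntAt
  rw [hchar, Ideal.map_span, Set.image_singleton]
  exact (span_singleton_eq_of_C_pow_mul_mem_of_le ha hQm hFn hm).symm

omit [W.IsGloballyMinimal] in
/-- **c3s♭′ from ROAD H and ONE inequality.** `X2.HidaLimitRevDivOnTreeIntOther W p`
(`Q ∣ p^a 𝓕♭` at every datum, sign-free) together with, at every datum of this sign: `X := X_ac^∅`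
strict at `𝔭̄` `Λ`-torsion, `μ(X) = 0`, and `Q` with first unit coefficient at some `m ≥ λ(X)` (i.e.
`μ(𝓛) = 0` and `λ(X) ≤ λ(𝓛)`), gives `X2.SplitIMCEqOnTreeIntOther W p`; here `λ(𝓛) ≤ λ(X)` is free (§1).
Hypothesis stated INLINE; CONDITIONAL; nothing booked.
[cite: KellerYin2024, §5.1 (a)–(e), Lemma 5.1.2 and Thm. 5.1.3 (arXiv:2402.12781v2) (shape only; nothing asserted)]
[cite: Washington1997, §13.2 and §7.1 Prop. 7.2] -/
theorem splitIMCEqOnTreeIntOther_of_hidaLimitRevDivIntOther_of_le_lambda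
    (hrev : HidaLimitRevDivOnTreeIntOther W p)
    (h :
    ∀ (N : ℕ) [NeZero N] (K : Type) [Field K] [NumberField K] (Dt : ModularParametrizationData W N)
      (H : HeegnerDatum N (NumberField.discr K)) (ιK : K →+* ℂ) (P : (W.baseChange K).toAffine.Point),
      CellC W p → W.HasSplitMultiplicativeReductionAtPrime p → W.conductorNorm ℤ = N →
      IsImaginaryQuadratic K → NumberField.discr K < -4 → SatisfiesHeegnerHypothesis N K →
      (W.quadraticTwist (NumberField.discr K : ℚ)).entireLFunction 1 ≠ 0 →
      WeierstrassCurve.Affine.Point.map ιK.toRatAlgHom P = heegnerPointComplex Dt H →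
      ¬ (p : ℤ) ∣ Dt.c → ¬ IsOfFinAddOrder P →
      Odd (NumberField.discr K) →
      ∀ (κ : ZpExtension K p), κ.IsAnticyclotomic →
        ∀ (γ : Field.absoluteGaloisGroup K) [Fact (κ.IsTopGenerator γ)]
          (𝔭 : HeightOneSpectrum (𝓞 K)), ((p : ℕ) : 𝓞 K) ∈ 𝔭.asIdeal →
          𝔭.asIdeal.ramificationIdx (𝓞 ℚ) = 1 → 𝔭.asIdeal.inertiaDeg (𝓞 ℚ) = 1 →
          ∀ (𝔭bar : HeightOneSpectrum (𝓞 K)), ((p : ℕ) : 𝓞 K) ∈ 𝔭bar.asIdeal → 𝔭bar ≠ 𝔭 →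
            ((Ideal.span {(p : ℤ)}).primesOver (𝓞 K)).ncard = 2 →
          ∀ (f : CuspForm (CongruenceSubgroup.Gamma0 N) 2), IsNewformOf W f →
            ∀ (ι' : PadicAlgCl p ≃+* ℂ),
              (∀ (w : InfinitePlace K) (k : 𝓞 K),
                k ∈ 𝔭.asIdeal ↔ ‖ι'.symm (w.embedding (k : K))‖ < 1) →
              ∀ (ΩK : ℂ) (Ωp : ℂ_[p]) (Q : PowerSeries 𝓞_ℂ_[p]), ΩK ≠ 0 → ‖Ωp‖ = 1 →
                R1.IsBDPLFunctionInt p ι' 𝔭 κ γ f ΩK Ωp Q →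
                  Module.IsTorsion (IwasawaAlgebra p) (XAc (W.baseChange K) p κ 𝔭bar ∅ γ) ∧
                  muInvariant p (XAc (W.baseChange K) p κ 𝔭bar ∅ γ) = 0 ∧
                  ∃ m, lambdaInvariant p (XAc (W.baseChange K) p κ 𝔭bar ∅ γ) ≤ m ∧
                    ‖((PowerSeries.coeff m Q : 𝓞_ℂ_[p]) : ℂ_[p])‖ = 1 ∧
                      ∀ i < m, ‖((PowerSeries.coeff i Q : 𝓞_ℂ_[p]) : ℂ_[p])‖ < 1) :
    SplitIMCEqOnTreeIntOther W p := by
  intro N _ K _ _ Dt H ιK P hc hs hN hK hd4 hHN hLt hP hcM hPinf hodd κ hκ γ _ 𝔭 h𝔭 he hf 𝔭bar h𝔭bar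
    hne hsplit f hfW ι' hι' ΩK Ωp Q hΩK hΩp hQ
  obtain ⟨F, hF⟩ :=
    (charIdeal_isPrincipal_holds p (XAc (W.baseChange K) p κ 𝔭bar ∅ γ)).principal
  have hchar : XAc.charIdeal (W.baseChange K) p κ 𝔭bar ∅ γ = Ideal.span {F} := hF
  obtain ⟨a, ha⟩ := hrev N K Dt H ιK P hc hN hK hd4 hHN hLt hP hcM hPinf hodd κ hκ γ 𝔭 h𝔭 he hf 𝔭bar
    h𝔭bar hne hsplit f hfW ι' hι' ΩK Ωp Q hΩK hΩp hQ
    F hchar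
  obtain ⟨htor, hμ, m, hm, hQm⟩ := h N K Dt H ιK P hc hs hN hK hd4 hHN hLt hP hcM hPinf hodd κ hκ γ 𝔭 h𝔭 he
    hf 𝔭bar h𝔭bar hne hsplit f hfW ι' hι' ΩK Ωp Q hΩK hΩp hQ
  haveI := module_finite_XAc_baseChange (W := W) p κ 𝔭bar γ
  have hFn := firstUnitCoeff_map_toCpInt_of_charIdeal_eq_span _ htor hμ hchar
  unfold R1.IMCEqIntAt
  rw [hchar, Ideal.map_span, Set.image_singleton]
  exact (span_singleton_eq_of_C_pow_mul_mem_of_le ha hQm hFn hm).symm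

end Roads

end Summit.BirchSwinnertonDyer.BirchSwinnertonDyer.Theorems.StubC3OneInequality

end
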